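import Summits.CriticalPhenomena.PercolationContinuityZ3.Theorems.FK.NewmanDominatedInequality
import Summits.CriticalPhenomena.PercolationContinuityZ3.Theorems.FK.NewmanCLTBlocks
import HarnessLib

/-!
# NEWMAN'S BLOCK ESTIMATE FOR DOMINATED (NON-MONOTONE) FIELDS: for a field `X` dominated by an increasing field `X̃`
# under a positively associated measure, `|E e^{is(S_A − E S_A)} − exp(−s² W/2)| ≤ 2 s² (Ṽ − W̃) + #blocks·(|s|³K³ + s⁴K⁴)`

Claimed R42 (8)(c) in the cell INBOX at 2026-08-28T14:25:01Z by fkp-10a gen 354 (NEW CLAIM #3 of the gen), addressed to coordinator fk-4 g274 (seated 13:10Z 2026-08-28 by l.8389; R151 l.8390, R152 l.8413); lineage row FO-10a-g354g (self-suggested), package g354-cltgeneral, label GD-B.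
Helper file of the `fk-continuity` build cell (bschramm lane; `--supports stmt-CriticalPhenomena-4575`); builds on
p205010 (kernel theorem, internal audit signed; external expert review pending). No definitions, no named facts, no
sorries; standard axioms. UNCONDITIONAL. GENERIC.

`NewmanCLTBlocks.lean` treats INCREASING fields. Here the field `X : Site d → Ω → ℝ` (measurable, `|X_z| ≤ M`,
covariances `Cov(X_x, X_y) = γ(y − x)`) is only assumed DOMINATED by a measurable bounded field `X̃`
(`|X_z ω' − X_z ω| ≤ X̃_z ω' − X̃_z ω` for `ω ≤ ω'`; then `X̃_z` is increasing) with covariances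
`Cov(X̃_x, X̃_y) = γ̃(y − x)`: every bounded function of finitely many edge variables is of this kind
(`X̃ = M'·#open edges`). The block sums of `X` are dominated by those of `X̃`, so Newman's inequality for dominated
families (`norm_integral_cexp_sum_mul_sub_prod_le_of_dominated`) and the second-order expansion give, for any finite
region `A` and block labelling `β` with fibres of at most `κ` sites and `s²(2Mκ)² ≤ 2`:

* `norm_integral_cexp_blockSum_sub_exp_le_of_dominated` —
  `‖E exp(is(S_A − E S_A)) − exp(−s² W/2)‖ ≤ 2 s² (Ṽ − W̃) + #β(A)·(|s|³(2Mκ)³ + s⁴(2Mκ)⁴)`, where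
  `W = Σ_u Σ_{x,y∈block u} γ(y−x) = Σ_u Var B_u` (from `X`) and `Ṽ − W̃` is the cross-block covariance of the
  DOMINATING field (`Ṽ = Σ_{x,y∈A} γ̃(y−x)`, `W̃ = Σ_u Σ_{x,y∈block u} γ̃(y−x)`);
* bookkeeping: `dominated_fieldSum`, `sum_sum_kernel_self_nonneg` (`Σ_{x,y∈F} γ(y−x) = Var B_F ≥ 0` without
  monotonicity), `abs_sum_sum_kernel_le` (`|Σ_{x∈F,y∈F'} γ(y−x)| ≤ #F · Σ_z |γ(z)|`).

## References

* C. M. Newman, *Normal fluctuations and the FKG inequalities*, Comm. Math. Phys. 74 (1980) 119–128, Thm. 1, Thm. 2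
  and the remark after (12). [Newman1980]
* G. Grimmett, *The Random-Cluster Model*, Springer 2006, Thm. (4.17)(b), (4.19)(b). [Grimmett2006]
-/

noncomputable section

namespace Summit.CriticalPhenomena.PercolationContinuityZ3.Theorems.FK

namespace NewmanCLT

open MeasureTheory ProbabilityTheory Complex Finset
open Literature.Probability.Percolation Literature.Probability.LatticeModels

variable {Ω : Type*} {d : ℕ} {X Xd : Site d → Ω → ℝ} {M : ℝ} {γ γd : Site d → ℝ}

/-! ### Dominated block sums -/

/-- Block sums of a dominated field are dominated by the block sums of the dominating field.
[cite: Newman1980, Thm. 1 (proof)] -/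
theorem dominated_fieldSum [Preorder Ω] (hdom : ∀ z, ∀ ⦃ω ω'⦄, ω ≤ ω' → |X z ω' - X z ω| ≤ Xd z ω' - Xd z ω)
    (F : Finset (Site d)) :
    ∀ ⦃ω ω'⦄, ω ≤ ω' → |∑ z ∈ F, X z ω' - ∑ z ∈ F, X z ω| ≤ ∑ z ∈ F, Xd z ω' - ∑ z ∈ F, Xd z ω :=
  dominated_sum F fun z _ => hdom z

/-- A dominating field is increasing. [folklore] -/
theorem monotone_of_dominated_field [Preorder Ω]
    (hdom : ∀ z, ∀ ⦃ω ω'⦄, ω ≤ ω' → |X z ω' - X z ω| ≤ Xd z ω' - Xd z ω) (z : Site d) : Monotone (Xd z) :=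
  monotone_of_dominated (hdom z)

section Measurable

variable [MeasurableSpace Ω] {μ : Measure Ω} [IsProbabilityMeasure μ]

/-- `Σ_{x,y∈F} γ(y−x) = Var(Σ_{z∈F} X_z) ≥ 0` (no monotonicity needed). [folklore] -/
theorem sum_sum_kernel_self_nonneg (hXm : ∀ z, Measurable (X z)) (hXb : ∀ z ω, |X z ω| ≤ M)
    (hcov : ∀ x y, cov[X x, X y; μ] = γ (y - x)) (F : Finset (Site d)) : 0 ≤ ∑ x ∈ F, ∑ y ∈ F, γ (y - x) := by
  rw [← covariance_blockSum_eq hXm hXb hcov F F, covariance_self (measurable_fieldSum hXm F).aemeasurable]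
  exact variance_nonneg _ _

/-- `|Σ_{x∈F} Σ_{y∈F'} γ(y−x)| ≤ #F · Σ_z |γ(z)|` for a summable kernel. [folklore] -/
theorem abs_sum_sum_kernel_le [DecidableEq (Site d)] (hγ : Summable γ) (F F' : Finset (Site d)) :
    |∑ x ∈ F, ∑ y ∈ F', γ (y - x)| ≤ #F * ∑' z, |γ z| := by
  have hγa : Summable fun z => |γ z| := hγ.abs
  refine (Finset.abs_sum_le_sum_abs _ _).trans ?_
  have hrow : ∀ x ∈ F, |∑ y ∈ F', γ (y - x)| ≤ ∑' z, |γ z| := by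
    intro x _
    refine (Finset.abs_sum_le_sum_abs _ _).trans ?_
    rw [← Finset.sum_image (f := fun z => |γ z|) (s := F') (g := fun y => y - x) (fun a _ b _ h => sub_left_injective h)]
    exact hγa.sum_le_tsum _ fun z _ => abs_nonneg _
  calc ∑ x ∈ F, |∑ y ∈ F', γ (y - x)| ≤ ∑ _x ∈ F, ∑' z, |γ z| := Finset.sum_le_sum hrow
    _ = #F * ∑' z, |γ z| := by rw [Finset.sum_const, nsmul_eq_mul]

/-! ### The finite-volume estimate for dominated fields -/

/-- **NEWMAN'S BLOCK ESTIMATE FOR A DOMINATED FIELD** (finite volume): `μ` positively associated; `X` measurable with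
`|X_z| ≤ M`, `M ≥ 0`, covariances `γ(y − x)`, dominated by the measurable bounded field `X̃` with covariances `γ̃(y − x)`;
`A` a finite region, `β` a label map with fibres of at most `κ` sites, `s²(2Mκ)² ≤ 2`. Then
`‖E exp(is(S_A − E S_A)) − exp(−s² W/2)‖ ≤ 2 s² (Ṽ − W̃) + #β(A)·(|s|³(2Mκ)³ + s⁴(2Mκ)⁴)` with `W` the within-block
variance of `X` and `Ṽ − W̃` the cross-block covariance of `X̃`. [cite: Newman1980, Thm. 1 (11), remark after (12), proof of Thm. 2] -/
theorem norm_integral_cexp_blockSum_sub_exp_le_of_dominated [Preorder Ω] [DecidableEq (Site d)]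
    (hμ : IsPositivelyAssociated μ) (hXm : ∀ z, Measurable (X z)) (hM : 0 ≤ M) (hXb : ∀ z ω, |X z ω| ≤ M)
    (hcov : ∀ x y, cov[X x, X y; μ] = γ (y - x)) (hXdm : ∀ z, Measurable (Xd z)) {Md : ℝ}
    (hXdb : ∀ z ω, |Xd z ω| ≤ Md) (hcovd : ∀ x y, cov[Xd x, Xd y; μ] = γd (y - x))
    (hdom : ∀ z, ∀ ⦃ω ω'⦄, ω ≤ ω' → |X z ω' - X z ω| ≤ Xd z ω' - Xd z ω)
    (A : Finset (Site d)) (β : Site d → Site d) {κ : ℕ} (hfib : ∀ u, #(A.filter (fun z => β z = u)) ≤ κ) {s : ℝ}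
    (hs : s ^ 2 * (2 * M * κ) ^ 2 ≤ 2) :
    ‖∫ ω, cexp (((s * (∑ z ∈ A, X z ω - ∫ ω', ∑ z ∈ A, X z ω' ∂μ) : ℝ) : ℂ) * I) ∂μ -
        ((Real.exp (-(s ^ 2 * (∑ u ∈ A.image β, ∑ x ∈ A.filter (fun z => β z = u),
          ∑ y ∈ A.filter (fun z => β z = u), γ (y - x)) / 2)) : ℝ) : ℂ)‖ ≤
      2 * s ^ 2 * ((∑ x ∈ A, ∑ y ∈ A, γd (y - x)) -
          ∑ u ∈ A.image β, ∑ x ∈ A.filter (fun z => β z = u), ∑ y ∈ A.filter (fun z => β z = u), γd (y - x)) +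
        #(A.image β) * (|s| ^ 3 * (2 * M * κ) ^ 3 + s ^ 4 * (2 * M * κ) ^ 4) := by
  set U : Finset (Site d) := A.image β with hU
  set F : Site d → Finset (Site d) := fun u => A.filter (fun z => β z = u) with hF
  set Z : Site d → Ω → ℝ := fun u ω => ∑ z ∈ F u, X z ω - ∫ ω', ∑ z ∈ F u, X z ω' ∂μ with hZ
  set Bd : Site d → Ω → ℝ := fun u ω => ∑ z ∈ F u, Xd z ω with hBd
  set K : ℝ := 2 * M * κ with hK
  have hZm : ∀ u ∈ U, Measurable (Z u) := fun u _ => (measurable_fieldSum hXm (F u)).sub_const _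
  have hBdm : ∀ u ∈ U, Measurable (Bd u) := fun u _ => measurable_fieldSum hXdm (F u)
  have hZK : ∀ u ∈ U, ∀ ω, |Z u ω| ≤ K := fun u _ ω => by
    refine (abs_fieldSum_sub_integral_le hXb (F u) ω).trans ?_
    simp only [hK]
    exact mul_le_mul_of_nonneg_left (by exact_mod_cast hfib u) (by positivity)
  have hZb : ∀ u ∈ U, ∃ C, ∀ ω, |Z u ω| ≤ C := fun u hu => ⟨K, hZK u hu⟩
  have hBdb : ∀ u ∈ U, ∃ C, ∀ ω, |Bd u ω| ≤ C := fun u _ => ⟨_, abs_fieldSum_le hXdb (F u)⟩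
  have hZ0 : ∀ u ∈ U, ∫ ω, Z u ω ∂μ = 0 := fun u _ => by
    simp only [hZ]
    rw [integral_sub (integrable_finsetSum _ fun x _ => integrable_of_abs_le (hXm x) (hXb x)) (integrable_const _),
      integral_const, probReal_univ, one_smul, sub_self]
  have hdomZ : ∀ u ∈ U, ∀ ⦃ω ω'⦄, ω ≤ ω' → |Z u ω' - Z u ω| ≤ Bd u ω' - Bd u ω := fun u _ =>
    dominated_sub_const (dominated_fieldSum hdom (F u)) _
  -- Newman's inequality for the dominated family, all coefficients `s`
  have hN := norm_integral_cexp_sum_mul_sub_prod_le_of_dominated hμ U hZm hBdm hZb hBdb hdomZ (fun _ => s)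
  -- the second-order product expansion
  have hP := norm_prod_integral_cexp_sub_exp_le (μ := μ) U hZm hZK hZ0 (s := s) (by simpa [hK] using hs)
  -- covariances
  have hcovBd : ∀ u u', cov[Bd u, Bd u'; μ] = ∑ x ∈ F u, ∑ y ∈ F u', γd (y - x) := fun u u' =>
    covariance_blockSum_eq hXdm hXdb hcovd (F u) (F u')
  have hvarZ : ∀ u, Var[Z u; μ] = ∑ x ∈ F u, ∑ y ∈ F u, γ (y - x) := fun u => by
    rw [← covariance_self ((measurable_fieldSum hXm (F u)).sub_const _).aemeasurable]
    exact covariance_blockSum_sub_integral_eq hXm hXb hcov (F u) (F u)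
  have hsum : 2 * ∑ u ∈ U, ∑ u' ∈ U.erase u, |s| * |s| * cov[Bd u, Bd u'; μ] =
      2 * s ^ 2 * ((∑ x ∈ A, ∑ y ∈ A, γd (y - x)) - ∑ u ∈ U, ∑ x ∈ F u, ∑ y ∈ F u, γd (y - x)) := by
    have habs : |s| * |s| = s ^ 2 := by rw [← abs_mul, ← sq, abs_of_nonneg (sq_nonneg s)]
    simp_rw [habs, hcovBd]
    rw [← sum_sum_covSum_blocks_eq A β γd, ← hU]
    have herase : ∀ u ∈ U, ∑ u' ∈ U.erase u, s ^ 2 * ∑ x ∈ F u, ∑ y ∈ F u', γd (y - x) =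
        s ^ 2 * (∑ u' ∈ U, ∑ x ∈ F u, ∑ y ∈ F u', γd (y - x)) - s ^ 2 * ∑ x ∈ F u, ∑ y ∈ F u, γd (y - x) := by
      intro u hu
      rw [← Finset.mul_sum, Finset.sum_erase_eq_sub hu, mul_sub]
    rw [Finset.sum_congr rfl herase, Finset.sum_sub_distrib, ← Finset.mul_sum, ← Finset.mul_sum]
    ring
  have hlhs : ∀ ω, cexp (((s * (∑ z ∈ A, X z ω - ∫ ω', ∑ z ∈ A, X z ω' ∂μ) : ℝ) : ℂ) * I) =
      cexp (((∑ u ∈ U, s * Z u ω : ℝ) : ℂ) * I) := by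
    intro ω
    rw [sum_sub_integral_eq_sum_blocks hXm hXb A β ω, Finset.mul_sum]
  simp_rw [hlhs]
  rw [show (∑ u ∈ U, Var[Z u; μ]) = ∑ u ∈ U, ∑ x ∈ F u, ∑ y ∈ F u, γ (y - x) from
    Finset.sum_congr rfl fun u _ => hvarZ u] at hP
  rw [hsum] at hN
  calc _ ≤ ‖∫ ω, cexp (((∑ u ∈ U, s * Z u ω : ℝ) : ℂ) * I) ∂μ - ∏ u ∈ U, ∫ ω, cexp (((s * Z u ω : ℝ) : ℂ) * I) ∂μ‖ +
        ‖∏ u ∈ U, ∫ ω, cexp (((s * Z u ω : ℝ) : ℂ) * I) ∂μ -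
          ((Real.exp (-(s ^ 2 * (∑ u ∈ U, ∑ x ∈ F u, ∑ y ∈ F u, γ (y - x)) / 2)) : ℝ) : ℂ)‖ :=
        norm_sub_le_norm_sub_add_norm_sub _ _ _
    _ ≤ _ := add_le_add hN hP

end Measurable

end NewmanCLT

end Summit.CriticalPhenomena.PercolationContinuityZ3.Theorems.FK
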